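import Mathlib
import Summits.Ventures.PercRepro2.TB14HallJunction
import Summits.Ventures.PercRepro2.TB14Profile
import Summits.Ventures.PercRepro2.Induced

/-!
# Row 2′TB (typed BHK 1.4 single-vertex): THE STATEMENT OF RECORD OF THE (TB14) LINE AS A NAMED
PROP — Hall on the junction class for the VCM-localised flips (family 15) — and `TB14` from it
(blind cell PercRepro2, p5 g5, 2026-08-25; P5-RULES.md §6.4–§6.7, S4 §2.1 (g) (v); the lead's
ruling INBOX 4521: «p5 may file the family-15 class-preserving junction statement as its Lean Prop»)

FAMILY 15 of a configuration `y` (`Fam15`): the finite vertex sets `Z` with `o ∈ Z`, `a₂ ∉ Z`,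
`Z ⊆ T ∪ T′` (the region of `a₂`: its first- and second-copy clusters) and `Z` CONNECTED in the
induced graph `G[Z]` (all edges, both colours: `induced ends ↑Z (fun _ => true)`). The moves of a
bad source `y` are the bad targets of the form `starFlip ends Z y`, `Z ∈ Fam15 y` (`fam15Targets`).

* `JunctionHall15`: for every finite graph, marks and the all-free profile, Hall's condition for
  the bad sources with these moves — the statement of record of the line, census-true on every
  connected graph with `n ≤ 7` vertices (all `m`) and `n = 8`, `m ≤ 10` (two codes two seats at
  `n ≤ 7`: kits j242676 / j242677 and the engine's j243908), unproved;
* `tb14_allFree_of_junctionHall15`: it gives the (TB14) inequality at the all-free profile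
  (`TB14Hall.tb14_of_hall_junction`);
* **`tb14_of_junctionHall15 : JunctionHall15 → TB14 R`**: it gives the named conditional Prop
  `A3InactiveTyped.TB14` at EVERY profile (mine-c's `TB14Cut.TB14_of_allFree`).

A conditional bridge, no proof of the row; standard axioms.
-/

namespace Summit.Ventures.PercRepro2

namespace TB14Family15

open CovForm A3InactiveTyped TB14Fold TB14FlipFamily TB14Hall

section Family

variable {V : Type} {E : Type} [Fintype E] [DecidableEq E]
variable (ends : E → Sym2 V) (a₁ a₂ b o : V) (F : Finset E) (z : Config E)

/-- **Family 15** (the VCM-localised flips): `o ∈ Z`, `a₂ ∉ Z`, every vertex of `Z` in the region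
of `a₂` (joined to `a₂` in the first or in the second copy), and `Z` connected in the induced
graph `G[Z]` on all edges. -/
def Fam15 (y : Config E) (Z : Finset V) : Prop :=
  o ∈ Z ∧ a₂ ∉ Z ∧
    (∀ v ∈ Z, Conn ends y a₂ v ∨ Conn ends (A3InactiveTyped.flipOn F y) a₂ v) ∧
    ∀ v ∈ Z, Conn ends (induced ends (↑Z) (fun _ => true)) o v

open Classical in
/-- The bad targets reachable from `y` by a family-15 star flip. -/
noncomputable def fam15Targets (y : Config E) : Finset (Config E) :=
  (badTgtSet ends a₁ a₂ b o F z).filter fun w =>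
    ∃ Z : Finset V, Fam15 ends a₂ o F y Z ∧ w = starFlip ends Z y

/-- The family-15 moves land in the bad targets (by definition). -/
lemma fam15Targets_subset (y : Config E) :
    fam15Targets ends a₁ a₂ b o F z y ⊆ badTgtSet ends a₁ a₂ b o F z := by
  classical
  exact Finset.filter_subset _ _

open Classical in
/-- The CLASS-PRESERVING family-15 moves: the bad targets reachable by a family-15 star flip that
keep the class of `b` (J1 = `b` in the second-copy cluster of `a₂`, J2 = outside). -/
noncomputable def fam15ClassTargets (y : Config E) : Finset (Config E) :=
  (fam15Targets ends a₁ a₂ b o F z y).filter fun w =>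
    (Conn ends (A3InactiveTyped.flipOn F w) a₂ b ↔ Conn ends (A3InactiveTyped.flipOn F y) a₂ b)

/-- The class-preserving moves are family-15 moves. -/
lemma fam15ClassTargets_subset (y : Config E) :
    fam15ClassTargets ends a₁ a₂ b o F z y ⊆ fam15Targets ends a₁ a₂ b o F z y := by
  classical
  exact Finset.filter_subset _ _

end Family

section Statement

/-- **THE STATEMENT OF RECORD OF THE (TB14) LINE** (P5-RULES.md §6.4, S4 §2.1 (g) (v)): on every
finite graph, for every choice of the marks, at the all-free profile, Hall's condition holds for the
bad sources (the junction class) with the family-15 moves into the bad targets. Census-true through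
`n = 7` (all `m`) and `n = 8` (`m ≤ 10`); unproved. -/
def JunctionHall15 : Prop :=
  ∀ (V E : Type) [Fintype E] [DecidableEq E] (ends : E → Sym2 V) (a₁ a₂ b o : V),
    ∀ S ⊆ badSrcSet ends a₁ a₂ b o Finset.univ (fun _ => false),
      S.card ≤ (S.biUnion (fam15Targets ends a₁ a₂ b o Finset.univ (fun _ => false))).card

/-- **The CLASS-PRESERVING form** (P5-RULES.md §6.7): Hall's condition for the bad sources with the
family-15 moves that keep the class of `b` — the J1 sources into the J1 targets, the J2 sources
into the J2 targets. Census-true through `n = 7` (all `m`) and `n = 8` (`m ≤ 10`); unproved. -/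
def JunctionHall15Class : Prop :=
  ∀ (V E : Type) [Fintype E] [DecidableEq E] (ends : E → Sym2 V) (a₁ a₂ b o : V),
    ∀ S ⊆ badSrcSet ends a₁ a₂ b o Finset.univ (fun _ => false),
      S.card ≤ (S.biUnion (fam15ClassTargets ends a₁ a₂ b o Finset.univ (fun _ => false))).card

/-- The class-preserving form implies the plain one (fewer moves, the same sources). -/
theorem junctionHall15_of_class (h : JunctionHall15Class) : JunctionHall15 := by
  intro V E _ _ ends a₁ a₂ b o S hS
  classical
  refine (h V E ends a₁ a₂ b o S hS).trans (Finset.card_le_card ?_)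
  exact Finset.biUnion_mono fun y _ =>
    fam15ClassTargets_subset ends a₁ a₂ b o Finset.univ (fun _ => false) y

variable {R : Type*} [Field R] [LinearOrder R] [IsStrictOrderedRing R]

/-- `JunctionHall15` gives the (TB14) inequality at the all-free profile on every finite graph. -/
theorem tb14_allFree_of_junctionHall15 (h : JunctionHall15) (V E : Type) [Fintype E]
    [DecidableEq E] (ends : E → Sym2 V) (a₁ a₂ b o : V) :
    pairCount Finset.univ (fun _ => false) (sameBO ends a₁ a₂ b o : Config E → Config E → R) ≤
      pairCount Finset.univ (fun _ => false) (crossBO ends a₁ a₂ b o) :=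
  tb14_of_hall_junction ends a₁ a₂ b o Finset.univ (fun _ => false)
    (fam15Targets ends a₁ a₂ b o Finset.univ (fun _ => false))
    (fun y _ => fam15Targets_subset ends a₁ a₂ b o Finset.univ (fun _ => false) y)
    (h V E ends a₁ a₂ b o)

/-- **`JunctionHall15 → TB14 R`**: the statement of record of the line implies the named
conditional Prop of row 2′TB at every profile (through mine-c's `TB14Cut.TB14_of_allFree`). -/
theorem tb14_of_junctionHall15 (h : JunctionHall15) : TB14 R :=
  TB14Cut.TB14_of_allFree R fun V E _ _ ends a₁ a₂ b o =>
    tb14_allFree_of_junctionHall15 (R := R) h V E ends a₁ a₂ b o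

/-- **`JunctionHall15Class → TB14 R`**: the class-preserving statement of record implies `TB14`. -/
theorem tb14_of_junctionHall15Class (h : JunctionHall15Class) : TB14 R :=
  tb14_of_junctionHall15 (junctionHall15_of_class h)

end Statement

end TB14Family15

end Summit.Ventures.PercRepro2
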